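import Mathlib
import Literature.Analysis.FluidPDE.Tao2016AveragedNS.BoundedEternalSolutions
import Summits.NavierStokesRegularity.NavierStokesRegularity.Theses.TaoLadderRungTwoBreak
import Summits.NavierStokesRegularity.NavierStokesRegularity.Theses.WakeRatchet
import Summits.NavierStokesRegularity.NavierStokesRegularity.Theorems.WakeRatchetBlockRateGlue
import Summits.NavierStokesRegularity.NavierStokesRegularity.Theorems.WakeRatchetRatchetStarvationBlock
import HarnessLib

/-!
# K1ᵛ(1) `TaoLadderRungTwoBreak.NoSurvivingEternalViscBddOne` (stmt-NavierStokesRegularity-20419) and BOTH its registered stubs are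
# CUT BY NAME by the rate cruxes of route `WakeRatchet`

MODEL lattice ODEs only (Tao 2016 §4, §6.4); nothing here is a statement about the Navier–Stokes equations; no stub, crux or summit is
closed (`--supports stmt-NavierStokesRegularity-20419`; the hypotheses are OPEN route items of route WakeRatchet, taken BY NAME).

Junction of the two routes that study the same bounded admissible eternal solutions of E₂(R) tables.  With route WakeRatchet's landed
block glue (`WakeRatchetBlockRate.blockRate_of_perShell`, `…TailRateRatchet_blockForm`) and block starvation
(`RatchetStarvationBlock.not_survivingFwd_of_blockRate`, `…noSurvivingEternalViscBdd_of_blockRateRatchet`):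

* `noSurvivingEternalViscBddOne_of_tailRateRatchet` — **crux ⟨20419⟩ ⟸ WakeRatchet's deciding crux ⟨25584⟩ `TailRateRatchet`** (a tail
  contraction `(1+ε₀)^{−a}`, `a > 1`, for every uniformly bounded admissible eternal solution, any covariant viscosity);
* `stub_noSurvivingEternalBddOne_of_eternalInviscidRate` — **the (ρ0) stub `stub_noSurvivingEternalBddOne` (registered signature
  `∀ R ≥ 1, NoSurvivingEternalBdd R 1`) ⟸ WakeRatchet's crux ⟨25646⟩ `EternalInviscidRate`** (the inviscid rate ratchet);
* `stub_noLoudLadderOne_of_eternalViscousRate` — **the (ρ+) stub `stub_noLoudLadderOne` (`∀ R ≥ 1, NoLoudLadder R`) ⟸ WakeRatchet's crux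
  ⟨25647⟩ `EternalViscousRate`** (the dissipation-balanced slice; the loudness hypothesis of `NoLoudLadder` is not even used).

READING for the census: ⟨20419⟩'s split (ρ0)/(ρ+) is implied stub-by-stub by WakeRatchet's split (A)/(B) of `TailRateRatchet` — the rate
form is the STRONGER statement (it asks a wake exponent `a > 1`; (S₁)-non-survival only needs the a=1-weighted energies to fade), so a
refutation of ⟨25646⟩/⟨25647⟩ does NOT refute ⟨20419⟩, while a proof closes it.  The numerics of this hand (evidence
`NUMERICS-20419-wake-exponent-leafhand4-g0.md`) measure the wake exponent of the blow-up-selected fronts: `a ≈ 1.21 … 5/3` on the dyadic /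
pump members of E₂(2), consistent with both.  HONEST LABEL: by-name bookkeeping; ⟨20419⟩, (ρ0), (ρ+), ⟨25584⟩, ⟨25646⟩, ⟨25647⟩ and every
NS statement remain OPEN.
-/

noncomputable section

-- the summit and its single sub-problem share the name (CONVENTIONS §1)
set_option linter.dupNamespace false

namespace Summit.NavierStokesRegularity.NavierStokesRegularity.Theorems.NoSurvivingEternalViscBddOne.OfWakeRatchet

open Filter Topology
open Literature.Analysis.FluidPDE Literature.Analysis.FluidPDE.TaoCascade
open Summit.NavierStokesRegularity.NavierStokesRegularity.Theses
open Summit.NavierStokesRegularity.NavierStokesRegularity.Theorems.WakeRatchetBlockRate (blockRate_of_perShell TailRateRatchet_blockForm)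
open Summit.NavierStokesRegularity.NavierStokesRegularity.Theorems.RatchetStarvationBlock
  (not_survivingFwd_of_blockRate noSurvivingEternalViscBdd_of_blockRateRatchet)

/-- **Crux ⟨20419⟩ ⟸ WakeRatchet ⟨25584⟩.**  The rate tail ratchet `WakeRatchet.TailRateRatchet` (any covariant viscosity) implies the
K1ᵛ(1) Liouville crux `TaoLadderRungTwoBreak.NoSurvivingEternalViscBddOne` BY NAME (block form with `b = 1`, then block starvation).
[cite: Tao2016AveragedNS, §4 Thm. 4.2 (statement shape), Lemma 4.1 (4.8)–(4.10), §6.4; tree WakeRatchet block glue + block starvation] -/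
theorem noSurvivingEternalViscBddOne_of_tailRateRatchet (hK : WakeRatchet.TailRateRatchet) :
    TaoLadderRungTwoBreak.NoSurvivingEternalViscBddOne := by
  intro R hR
  obtain ⟨a, ha, εs, hεs, H⟩ := TailRateRatchet_blockForm hK hR
  exact noSurvivingEternalViscBdd_of_blockRateRatchet
    ⟨a, ha, εs, hεs, fun ε₀ hε₀ hle => ⟨1, le_rfl, fun α hα νh W hW hU n M hM σ =>
      H ε₀ hε₀ hle 1 le_rfl α hα νh W hW hU n M hM σ⟩⟩

/-- **The (ρ0) stub ⟸ WakeRatchet ⟨25646⟩.**  The inviscid rate ratchet `WakeRatchet.EternalInviscidRate` implies the registered (ρ0) stub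
statement of ⟨20419⟩, `∀ R ≥ 1, NoSurvivingEternalBdd R 1` (bounded INVISCID Liouville at `a = 1`), BY NAME: for each uniformly bounded
admissible inviscid eternal solution the per-shell contraction is turned into the block form (`b = 1`) and starved
(`not_survivingFwd_of_blockRate` at `ν̂ = 0`).
[cite: Tao2016AveragedNS, §4 Thm. 4.2 (statement shape), Lemma 4.1 (4.8)–(4.10), §6.4; tree WakeRatchet block glue + block starvation] -/
theorem stub_noSurvivingEternalBddOne_of_eternalInviscidRate (hK : WakeRatchet.EternalInviscidRate) :
    ∀ R : ℝ, 1 ≤ R → NoSurvivingEternalBdd R 1 := by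
  intro R hR
  obtain ⟨a, ha, εs, hεs, H⟩ := hK R hR
  refine ⟨εs, hεs, ?_⟩
  intro ε₀ hε₀ hle α hα W hW hU
  refine not_survivingFwd_of_blockRate hε₀ hα.2.1 hW.isEternalVisc hU ha (b := 1) le_rfl ?_
  intro n M hM σ
  exact blockRate_of_perShell hε₀ (fun n' M' hM' σ' => H ε₀ hε₀ hle α hα W hW hU n' M' hM' σ') 1 n M hM σ

/-- **The (ρ+) stub ⟸ WakeRatchet ⟨25647⟩.**  The viscous rate ratchet `WakeRatchet.EternalViscousRate` (covariant viscosity `ν̂ > 0`)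
implies the registered (ρ+) stub statement of ⟨20419⟩, `∀ R ≥ 1, NoLoudLadder R` (loud-ladder exclusion), BY NAME — the loudness
hypothesis of `NoLoudLadder` (every shell reaches the dissipation-critical level) is not used.
[cite: Tao2016AveragedNS, §4, the viscous equation before Thm. 4.2, Lemma 4.1 (4.8)–(4.10), §6.4; tree WakeRatchet block glue + block starvation] -/
theorem stub_noLoudLadderOne_of_eternalViscousRate (hK : WakeRatchet.EternalViscousRate) :
    ∀ R : ℝ, 1 ≤ R → NoLoudLadder R := by
  intro R hR
  obtain ⟨a, ha, εs, hεs, H⟩ := hK R hR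
  refine ⟨εs, hεs, ?_⟩
  intro ε₀ hε₀ hle α hα νh W hν hW hU _hloud
  refine not_survivingFwd_of_blockRate hε₀ hα.2.1 hW hU ha (b := 1) le_rfl ?_
  intro n M hM σ
  exact blockRate_of_perShell hε₀ (fun n' M' hM' σ' => H ε₀ hε₀ hle α hα νh W hν hW hU n' M' hM' σ') 1 n M hM σ

/-- **Both WakeRatchet children give the crux** (the same as `noSurvivingEternalViscBddOne_of_tailRateRatchet` through the split, using the
tree's own glue `noSurvivingEternalViscBddOne_of`): ⟨25646⟩ ∧ ⟨25647⟩ ⟹ ⟨20419⟩.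
[cite: Tao2016AveragedNS, §4 Thm. 4.2 (statement shape), §6.4; tree `noSurvivingEternalViscBddOne_of`] -/
theorem noSurvivingEternalViscBddOne_of_rateChildren (hA : WakeRatchet.EternalInviscidRate)
    (hB : WakeRatchet.EternalViscousRate) : TaoLadderRungTwoBreak.NoSurvivingEternalViscBddOne :=
  fun R hR => noSurvivingEternalViscBddOne_of (stub_noSurvivingEternalBddOne_of_eternalInviscidRate hA R hR)
    (stub_noLoudLadderOne_of_eternalViscousRate hB R hR)

end Summit.NavierStokesRegularity.NavierStokesRegularity.Theorems.NoSurvivingEternalViscBddOne.OfWakeRatchet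

end
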